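import Mathlib
import Literature.Analysis.FluidPDE.NSCriticalClosureBesovKatoClass
import Literature.Analysis.FluidPDE.ClassicalSolution
import HarnessLib

/-!
# Cruxes `ColumnarCoreExclusion` (stmt-1966) / `MonopoleCoreExclusion` (stmt-1965): the PROVABLE conjunct of the anchor stubs —
# a maximal smooth Leray–Hopf solution from a decaying datum has a singular point, in the stubs' own phrasing

`--supports stmt-NavierStokesRegularity-1966` (helper file; theorems only, no definitions, no `sorry`; serves verbatim the first
conjunct of BOTH registered anchor stubs `stub_anchoredLateColumnarWitness` (1966) and `stub_anchoredLateAxisymWitness` (1965),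
which is class-independent).

The anchor stubs conclude `∃ xs, (¬ ∃ ρ M, 0 < ρ ∧ ∀ s ∈ Ioo (T − ρ²) T, ∀ x ∈ ball xs ρ, ‖u s x‖ ≤ M) ∧ (late witnesses anchored
at xs)`.  The first conjunct is IN THE TREE up to phrasing: a classical solution on `[0,T)`, Leray–Hopf from its rapidly decaying
datum, is the Kato solution (`isKatoSolutionOn_of_classical`), and if it does not extend past `T` it has a point `xs` with
`‖u‖_{L^∞(Q_r(T,xs))} = ∞` for all small `r` (`exists_singularPoint_of_classical_of_not_hasSmoothExtensionPast`, Lemarié-Rieusset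
2016 Thm. 15.1); since `Q_r(T, xs) = Ioo (T − r²) T ×ˢ ball xs r`, a bound `M` on `Ioo (T − ρ²) T × ball xs ρ` would bound the
essential supremum on `Q_{min ρ √(T/2)}` — `exists_singular_point_of_isMaximalSmoothSolution`.  The census of this hand records
that the REMAINING content of the anchor stubs is exactly lateness `(T − t)V ≤ KL` and common anchoring `dist xs x₀ ≤ KL/4` of
the witnesses (research).  Nothing about Navier–Stokes regularity is claimed.
-/

noncomputable section

open Set Metric MeasureTheory Function Filter Topology
open Literature.Analysis Literature.Analysis.FluidPDE
open scoped ENNReal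

namespace Summit.NavierStokesRegularity.NavierStokesRegularity.Theorems

-- the problem directory repeats the summit name (`NavierStokesRegularity/NavierStokesRegularity`)
set_option linter.dupNamespace false

namespace CoreExclusionAnchor

/-- **Singular point of a maximal smooth solution, in the anchor stubs' phrasing.**  Let `(u, p)` be a maximal smooth solution
of the unforced Navier–Stokes system on `ℝ³ × [0, T)` (`ν, T > 0`), Leray–Hopf on `[0, T]` from its rapidly decaying datum.  Then
some point `xs` is SINGULAR at time `T`: `u` is bounded on NO backward parabolic neighbourhood `(T − ρ², T) × B_ρ(xs)`.
[cite: LemarieRieusset2016, Thm. 15.1 (C)] -/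
theorem exists_singular_point_of_isMaximalSmoothSolution {ν T : ℝ}
    {u : ℝ → EuclideanSpace ℝ (Fin 3) → EuclideanSpace ℝ (Fin 3)} {p : ℝ → EuclideanSpace ℝ (Fin 3) → ℝ}
    (hν : 0 < ν) (hT : 0 < T) (hmax : IsMaximalSmoothSolution ν 0 u p T)
    (hLH : IsLerayHopfOn T ν 0 (u 0) u) (hdec : HasRapidSpatialDecay (u 0)) :
    ∃ xs : EuclideanSpace ℝ (Fin 3),
      ¬ ∃ ρ M : ℝ, 0 < ρ ∧ ∀ s ∈ Ioo (T - ρ ^ 2) T, ∀ x ∈ ball xs ρ, ‖u s x‖ ≤ M := by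
  obtain ⟨xs, hxs⟩ :=
    exists_singularPoint_of_classical_of_not_hasSmoothExtensionPast hν hT hmax.1 hLH hdec hmax.2
  refine ⟨xs, ?_⟩
  rintro ⟨ρ, M, hρ, hM⟩
  -- a small cylinder `Q_r(T, xs)`, `r ≤ ρ`, `r² < T`
  set r : ℝ := min ρ (Real.sqrt (T / 2)) with hr_def
  have hr0 : 0 < r := lt_min hρ (Real.sqrt_pos.2 (by positivity))
  have hrρ : r ≤ ρ := min_le_left _ _
  have hr2 : r ^ 2 < T := by
    calc r ^ 2 ≤ Real.sqrt (T / 2) ^ 2 := pow_le_pow_left₀ hr0.le (min_le_right _ _) 2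
      _ = T / 2 := Real.sq_sqrt (by positivity)
      _ < T := by linarith
  have hsub : parabolicCylinder r ((T : ℝ), xs) ⊆ Ioo (T - ρ ^ 2) T ×ˢ ball xs ρ := by
    rintro ⟨s, y⟩ hz
    rw [mem_parabolicCylinder] at hz
    have hr2ρ : r ^ 2 ≤ ρ ^ 2 := pow_le_pow_left₀ hr0.le hrρ 2
    exact ⟨⟨by linarith [hz.1.1], hz.1.2⟩, mem_ball.2 (hz.2.trans_le hrρ)⟩
  -- `u` is essentially bounded by `M` on the small cylinder …
  have hbd : eLpNorm (uncurry u) ∞ (volume.restrict (parabolicCylinder r ((T : ℝ), xs))) < ∞ := by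
    rw [eLpNorm_exponent_top]
    refine eLpNormEssSup_lt_top_of_ae_bound (C := M) ?_
    filter_upwards [ae_restrict_mem (isOpen_parabolicCylinder r ((T : ℝ), xs)).measurableSet] with z hz
    obtain ⟨s, y⟩ := z
    have h := hsub hz
    exact hM s h.1 y h.2
  -- … contradicting the singularity of `xs`
  exact hbd.ne (hxs r hr0 hr2)

end CoreExclusionAnchor

end Summit.NavierStokesRegularity.NavierStokesRegularity.Theorems

end
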